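import Summits.ResolutionOfSingularities.ResolutionOfSingularities.Theorems.WildConesCampaignW46ThreefoldsCharTwo

/-!
# [OURS · L1 W4.6, rung (i)] SURFACES `z^p = a(u₁,u₂)` embedded in 3-space, every characteristic `p`:
# the point-blow-up procedure in the FORCED regime — structure of the forced states (cleaned order
# exactly `p + 1`, hence inside the Moh window), Milnor drop, termination, and an effective bound

Cell res-hironaka (LADDER-RESOLUTION rung L, D-0089), slot W4.6 «restricted regimes as rungs», seat
res-L1-s46-pv-2: «(i) SURFACES, second prover: … the embedded-surface-in-3-space variant» (strategy
disjoint from res-L1-s46-pv-1's Hauser–Wagner height invariant). Host: route `WildCones`, crux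
`ClassicalRegimes` (stmt-ResolutionOfSingularities-16884, proved: `WildCones.ClassicalRegimes_proof`,
line `milnor-descent`), `--supports … --as helper`.

HONEST FRAMING. Everything here is OURS: theorems about route `WildCones`' own TYPED point-blow-up
dynamics (`Theorems/WildConesClassicalRegimesDefs.lean`: a state is the coefficient function `c` of
`a = Σ c(A) u^A ∈ κ⟦u₁,u₂⟧`, the atom is the SURFACE `z^p = a(u₁,u₂)` in 3-space; `step` = blow up the
closed point, chart `u_i`, divide by `u_i^p`, translate by `τ`, delete `p`-th powers; `Isol` = finite
Milnor algebra `κ⟦u⟧/(∂a)`, `MultP` = cleaned order `≥ p`, `OrdP`/`OrdPSucc` = a cleaned monomial of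
degree `p`/`p + 1`, `ord` = order, `mu` = `dim_κ κ⟦u⟧/(∂a)`; a state is FORCED when `Isol ∧ MultP`: an
isolated point of multiplicity `p`, where every centre rule — in particular the typed Th. 16.6 rule, see
`Theorems/MarkedTransferCampaignW46ForcedRegime.lean` (`CampaignW46.Run.centre_eq_sing`) — must blow up
the closed point). It REPLACES THE ROLE of Th. 16.6 (2) Eq. (127) (H. Hironaka, ms. 2017-03-23, p.84
l.10–20: strict lexicographic decrease of the résumé's `Inv`-string) and of Th. 16.13 (p.87 l.26–30:
«repeatedly but finitely many times») in ONE restricted regime — rung (i): surfaces `z^p = a(u₁,u₂)` in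
the forced regime, EVERY prime `p`, over a perfect field — with OUR OWN invariant, the Milnor number.
NOTHING here is a statement of the manuscript [Hironaka2017] and nothing of it is used; no FACT-LIST
premise is used; the scheme-level dictionary between the typed `CampaignW46.Step.blowup` and this
coefficient calculus is NOT in this file and is not claimed (its FORMAL half — «`step` is the equation
of the transform of `z^p = a` in the blow-up chart after the cleaning change of the `z`-coordinate» —
is the subject of the companion `Theorems/WildConesCampaignW46FormalDictionary.lean` of this seat).
`[PerfectField κ]` is kept where the crux's stubs use it (the cleaning step is the coordinate change
`z ↦ z + c^{1/p} u^{A/p}`, which needs `p`-th roots: the faithful geometric reading). AI review is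
weaker than expert review.

WHAT IS NEW relative to the landed crux (`Theorems/WildConesClassicalRegimes.lean`, whose
`mu_lt_of_infRun_two` is the Milnor descent along an INFINITE forced run) and to the rung-(ii) file of
res-L1-s46-pv-4 (`…CampaignW46ThreefoldsCharTwo`, `p = 2`):
* the STRUCTURE LEMMA of the forced surface regime, one step at a time and for every `p`: a forced
  state whose successor is forced has cleaned order EXACTLY `p + 1` (`not_ordP_of_forcedSuccessor`,
  `ordPSucc_of_forcedSuccessor`, `ord_clean_eq_of_forcedSuccessor`) — order `p` exits multiplicity `p`
  in one blow-up, order `≥ p + 2` has no isolated successor;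
* hence the LINK (i) ↔ (iii): such a state lies inside the Moh window `ord a < 2p` automatically
  (`ord_clean_lt_two_mul_of_forcedSuccessor`) — on surfaces the forced regime never meets the region
  `ord ≥ 2p` where rung (iii)'s barrier (`ResidualOrderUnbounded*`, Moh instability) lives;
* the ONE-STEP Milnor drop for every `p` with one step of look-ahead (`muDrop_of_forcedSuccessor₂`:
  states `c, c′, c″` forced ⇒ `μ(c′) < μ(c)`), the crux having it only along infinite runs;
* the EFFECTIVE form of «hence terminates»: a run of `z^p = a(u₁,u₂)` has at most `μ(c₀) + 1`
  consecutive forced states (`forcedPrefix_le_mu`, `exists_exit_le_mu_succ`);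
* the rung-(i) faces of termination (`not_infRun`, = the `n = 2` conjunct of the crux, re-exported under
  the campaign name so that the rung is citable BY NAME).

References: route file `Theses/WildCones.lean` (crux `ClassicalRegimes`, line `milnor-descent`);
G.-M. Greuel, G. Pfister, J. Algebra (2026) [GreuelPfister2026] and C. Huneke, I. Swanson, *Integral
closure* 14.3.4 — through the tree's stubs only; H. Hironaka, ms. 2017, Th. 16.6 p.84, Th. 16.13 p.87,
and T. T. Moh, 1987 (the window `ord < 2p`) — quoted for the ROLE replaced / the regime named only,
under adjudication resp. as context, not cited as fact.
-/

noncomputable section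

-- single-problem summit: the doubled namespace component `ResolutionOfSingularities` is forced
set_option linter.dupNamespace false

open scoped BigOperators Classical

namespace Summit.ResolutionOfSingularities.ResolutionOfSingularities.Theorems

namespace CampaignW46.Surfaces

open WildCones

variable {p : ℕ} {κ : Type} [Field κ]

/-! ## The structure of the forced surface regime: cleaned order exactly `p + 1` -/

/-- [OURS · L1 W4.6 rung (i); NOT a statement of the manuscript] **Order `p` exits.** A surface state
`z^p = a(u₁,u₂)` of multiplicity `p` whose point-blow-up successor again has multiplicity `p` is NOT
order-`p` cleaned: a cleaned (hence not a `p`-th power) binary form of degree `p` drops the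
multiplicity below `p` in one blow-up (the crux's `stub_ordPExitSurface`). [folklore] -/
theorem not_ordP_of_forcedSuccessor (hp : p.Prime) [CharP κ p] [PerfectField κ]
    (c : (Fin 2 → ℕ) → κ) (i : Fin 2) (τ : Fin 2 → κ) (hM : MultP p 2 κ c)
    (hM' : MultP p 2 κ (step p 2 κ i τ c)) : ¬ OrdP p 2 κ c :=
  fun hO => stub_ordPExitSurface p hp κ c i τ hM hO hM'

/-- [OURS · L1 W4.6 rung (i); NOT a statement of the manuscript] **Order `≥ p + 2` is not forced.** A
surface state of multiplicity `p` whose successor is an ISOLATED point of multiplicity `p` has a cleaned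
monomial of degree exactly `p + 1` (with `not_ordP_of_forcedSuccessor`: cleaned order exactly `p + 1`):
at cleaned order `≥ p + 2` the successor's gradient ideal lies in `(u_i)` and the Milnor algebra is
infinite (the crux's `stub_highOrdNotIsol`). [folklore] -/
theorem ordPSucc_of_forcedSuccessor (hp : p.Prime) [CharP κ p] [PerfectField κ]
    (c : (Fin 2 → ℕ) → κ) (i : Fin 2) (τ : Fin 2 → κ) (hM : MultP p 2 κ c)
    (hI' : Isol p 2 κ (step p 2 κ i τ c)) (hM' : MultP p 2 κ (step p 2 κ i τ c)) :
    OrdPSucc p 2 κ c := by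
  by_contra hS
  exact stub_highOrdNotIsol p hp 2 le_rfl κ c i τ hM (not_ordP_of_forcedSuccessor hp c i τ hM hM') hS hI'

/-- [OURS · L1 W4.6 rung (i); NOT a statement of the manuscript] **Cleaned order exactly `p + 1`.** For a
surface state of multiplicity `p` with a forced successor, the order of the cleaned series `a` is
`p + 1` on the nose. [folklore] -/
theorem ord_clean_eq_of_forcedSuccessor (hp : p.Prime) [CharP κ p] [PerfectField κ]
    (c : (Fin 2 → ℕ) → κ) (i : Fin 2) (τ : Fin 2 → κ) (hM : MultP p 2 κ c)
    (hI' : Isol p 2 κ (step p 2 κ i τ c)) (hM' : MultP p 2 κ (step p 2 κ i τ c)) :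
    ord 2 κ (clean p 2 κ c) = p + 1 := by
  have hO := not_ordP_of_forcedSuccessor hp c i τ hM hM'
  obtain ⟨A, hA, hsum⟩ := ordPSucc_of_forcedSuccessor hp c i τ hM hI' hM'
  unfold ord
  refine le_antisymm (Nat.sInf_le ⟨A, hA, hsum.symm⟩) (le_csInf ⟨_, A, hA, hsum.symm⟩ ?_)
  rintro m ⟨B, hB, rfl⟩
  have hge : p ≤ Finset.sum Finset.univ (fun j => B j) := hM.2 B hB
  have hne : Finset.sum Finset.univ (fun j => B j) ≠ p := fun h => hO ⟨B, hB, h⟩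
  omega

/-- [OURS · L1 W4.6, LINK rung (i) ↔ rung (iii); NOT a statement of the manuscript] **Forced surface
states live inside the Moh window.** A surface state `z^p = a(u₁,u₂)` of multiplicity `p` with a forced
successor satisfies `ord a < 2p` (indeed `ord a = p + 1` and `p ≥ 2`): on surfaces the forced regime of
the point-blow-up procedure never enters the region `ord a ≥ 2p` of rung (iii)'s barrier (Moh's
instability needs residual order `≥ 2p`-type growth; catalogued as `ResidualOrderUnbounded*`).
[folklore] -/
theorem ord_clean_lt_two_mul_of_forcedSuccessor (hp : p.Prime) [CharP κ p] [PerfectField κ]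
    (c : (Fin 2 → ℕ) → κ) (i : Fin 2) (τ : Fin 2 → κ) (hM : MultP p 2 κ c)
    (hI' : Isol p 2 κ (step p 2 κ i τ c)) (hM' : MultP p 2 κ (step p 2 κ i τ c)) :
    ord 2 κ (clean p 2 κ c) < 2 * p := by
  rw [ord_clean_eq_of_forcedSuccessor hp c i τ hM hI' hM']
  have := hp.two_le
  omega

/-! ## The Milnor drop, one step (with one step of look-ahead), every `p` -/

/-- [OURS · L1 W4.6 rung (i), replaces the ROLE of Th. 16.6 (2) Eq. (127) p.84 l.10–20 in this regime;
NOT a statement of the manuscript] **One-step Milnor drop on surfaces, every `p`.** If three consecutive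
states `c`, `c′ = step i τ c`, `c″ = step i′ τ′ c′` of the point-blow-up dynamics of `z^p = a(u₁,u₂)` over
a perfect field of characteristic `p` are forced (isolated of multiplicity `p`; of `c″` only the
multiplicity is used), then `μ(c′) < μ(c)`.
By the structure lemma `c` and `c′` have cleaned order exactly `p + 1`, and the crux's colength engine
`stub_muDropSurfaceOrdSucc` (weak transform of the gradient ideal, Huneke–Swanson 14.3.4) applies.
[folklore] -/
theorem muDrop_of_forcedSuccessor₂ (hp : p.Prime) [CharP κ p] [PerfectField κ]
    (c : (Fin 2 → ℕ) → κ) (i : Fin 2) (τ : Fin 2 → κ) (i' : Fin 2) (τ' : Fin 2 → κ)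
    (hI : Isol p 2 κ c) (hM : MultP p 2 κ c)
    (hI' : Isol p 2 κ (step p 2 κ i τ c)) (hM' : MultP p 2 κ (step p 2 κ i τ c))
    (hM'' : MultP p 2 κ (step p 2 κ i' τ' (step p 2 κ i τ c))) :
    mu p 2 κ (step p 2 κ i τ c) < mu p 2 κ c :=
  stub_muDropSurfaceOrdSucc p hp κ c i τ hI hM (not_ordP_of_forcedSuccessor hp c i τ hM hM')
    (ordPSucc_of_forcedSuccessor hp c i τ hM hI' hM') hI' hM'
    (not_ordP_of_forcedSuccessor hp _ i' τ' hM' hM'')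

/-! ## Termination in the forced regime (rung (i) face of the crux) and its effective form -/

/-- [OURS · L1 W4.6 rung (i), replaces the ROLE of Th. 16.13 p.87 l.26–30 («finitely many times») in this
regime; NOT a statement of the manuscript] **No infinite forced run on a surface.** Over a perfect field
of characteristic `p` (any prime `p`) no start state `c₀` of `z^p = a(u₁,u₂)`, chart word `i` and
translation word `t` make EVERY state of the point-blow-up dynamics an isolated point of multiplicity
`p`. This is the `n = 2` conjunct of the crux `ClassicalRegimes` (Milnor descent `mu_lt_of_infRun_two`),
re-exported under the campaign name. [folklore] -/
theorem not_infRun (hp : p.Prime) [CharP κ p] [PerfectField κ] (c₀ : (Fin 2 → ℕ) → κ)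
    (i : ℕ → Fin 2) (t : ℕ → Fin 2 → κ) : ¬ InfRun p 2 κ c₀ i t := fun hall =>
  no_strictAnti_nat (fun m => mu p 2 κ (run p 2 κ c₀ i t m)) (mu_lt_of_infRun_two hp hall)

/-- [OURS · L1 W4.6 rung (i); NOT a statement of the manuscript] Along a prefix of forced surface states
`μ` falls by at least one per step, up to the look-ahead: if the states `0, …, M + 1` of the run are
forced then `μ(state m) + m ≤ μ(c₀)` for all `m ≤ M`. [folklore] -/
theorem mu_add_le_of_forcedPrefix (hp : p.Prime) [CharP κ p] [PerfectField κ] (c₀ : (Fin 2 → ℕ) → κ)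
    (i : ℕ → Fin 2) (t : ℕ → Fin 2 → κ) {M : ℕ}
    (hpre : ∀ m ≤ M + 1, Isol p 2 κ (run p 2 κ c₀ i t m) ∧ MultP p 2 κ (run p 2 κ c₀ i t m)) :
    ∀ m ≤ M, mu p 2 κ (run p 2 κ c₀ i t m) + m ≤ mu p 2 κ c₀ := by
  intro m
  induction m with
  | zero => intro _; simp [run]
  | succ m ih =>
    intro hm
    have hdrop : mu p 2 κ (run p 2 κ c₀ i t (m + 1)) < mu p 2 κ (run p 2 κ c₀ i t m) :=
      muDrop_of_forcedSuccessor₂ hp _ (i m) (t m) (i (m + 1)) (t (m + 1))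
        (hpre m (by omega)).1 (hpre m (by omega)).2 (hpre (m + 1) (by omega)).1
        (hpre (m + 1) (by omega)).2 (hpre (m + 2) (by omega)).2
    have := ih (by omega)
    omega

/-- [OURS · L1 W4.6 rung (i), the campaign's «hence terminates» WITH A NUMBER; NOT a statement of the
manuscript] **Effective bound**: a run of the point-blow-up dynamics of `z^p = a(u₁,u₂)` over a perfect
field of characteristic `p` has at most `μ(c₀) + 1` consecutive forced states from the start — if the
states `0, …, M + 1` are all isolated points of multiplicity `p` then `M + 1 ≤ μ(c₀)`. [folklore] -/
theorem forcedPrefix_le_mu (hp : p.Prime) [CharP κ p] [PerfectField κ] (c₀ : (Fin 2 → ℕ) → κ)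
    (i : ℕ → Fin 2) (t : ℕ → Fin 2 → κ) {M : ℕ}
    (hpre : ∀ m ≤ M + 1, Isol p 2 κ (run p 2 κ c₀ i t m) ∧ MultP p 2 κ (run p 2 κ c₀ i t m)) :
    M + 1 ≤ mu p 2 κ c₀ := by
  have hM := mu_add_le_of_forcedPrefix hp c₀ i t hpre M le_rfl
  have hpos := ThreefoldsCharTwo.mu_pos hp.two_le (hpre M (by omega)).1 (hpre M (by omega)).2
  omega

/-- [OURS · L1 W4.6 rung (i); NOT a statement of the manuscript] **Exit within `μ(c₀) + 1` steps**: along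
every chart/translation word some state of `z^p = a(u₁,u₂)` of index `≤ μ(c₀) + 1` is NOT forced (not
isolated, or of multiplicity `< p`: the procedure has left the forced regime — it resolved the `p`-fold
point or met a non-isolated one, where a centre rule has a choice again). [folklore] -/
theorem exists_exit_le_mu_succ (hp : p.Prime) [CharP κ p] [PerfectField κ] (c₀ : (Fin 2 → ℕ) → κ)
    (i : ℕ → Fin 2) (t : ℕ → Fin 2 → κ) :
    ∃ m ≤ mu p 2 κ c₀ + 1, ¬ (Isol p 2 κ (run p 2 κ c₀ i t m) ∧ MultP p 2 κ (run p 2 κ c₀ i t m)) := by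
  by_contra h
  have key := forcedPrefix_le_mu hp c₀ i t (M := mu p 2 κ c₀) fun m hm => ?_
  · omega
  · by_contra h'
    exact h ⟨m, hm, h'⟩

/-- [OURS · L1 W4.6 rung (i); NOT a statement of the manuscript] **Every state of a forced surface prefix
is of cleaned order exactly `p + 1`**: if the states `0, …, M + 1` of a run of `z^p = a(u₁,u₂)` are
forced, the cleaned series of the states `0, …, M` all have order `p + 1` (`< 2p`: the run stays inside
the Moh window for as long as it stays forced). [folklore] -/
theorem ord_clean_eq_along_forcedPrefix (hp : p.Prime) [CharP κ p] [PerfectField κ]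
    (c₀ : (Fin 2 → ℕ) → κ) (i : ℕ → Fin 2) (t : ℕ → Fin 2 → κ) {M : ℕ}
    (hpre : ∀ m ≤ M + 1, Isol p 2 κ (run p 2 κ c₀ i t m) ∧ MultP p 2 κ (run p 2 κ c₀ i t m)) :
    ∀ m ≤ M, ord 2 κ (clean p 2 κ (run p 2 κ c₀ i t m)) = p + 1 := fun m hm =>
  ord_clean_eq_of_forcedSuccessor hp _ (i m) (t m) (hpre m (by omega)).2
    (hpre (m + 1) (by omega)).1 (hpre (m + 1) (by omega)).2

end CampaignW46.Surfaces

end Summit.ResolutionOfSingularities.ResolutionOfSingularities.Theorems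

end
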